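import Literature.NumberTheory.GelbartRogawski1991.LocalDoubledUnitarySplitMixedModel
import Literature.NumberTheory.GelbartRogawski1991.LocalUnitaryUndoubling
import Literature.NumberTheory.GelbartRogawski1991.LocalSplittingUnitary
import Literature.RepresentationTheory.HeisenbergGroup.MetaplecticSumStrippingRight
import HarnessLib

/-!
# The undoubled split datum at a split place is the mixed model twisted by `χ_w(det)⁻¹`
# ([Kudla1994, Thm 3.1]; [HarrisKudlaSweet1996, §1 (1.15)–(1.16)]; [MoeglinVignerasWaldspurger1987, Chap. 3 III.1])

Topic `NumberTheory/GelbartRogawski1991`; namespace `Literature.NumberTheory.GelbartRogawski1991.UnitaryDualPair.LocalSplitting`.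
KERNEL ONLY: theorems; no definition, no named fact, no `sorry`.

Setting of `LocalUnitaryUndoubling` at a place `v` of `F` SPLIT in `E` (`w ∣ v`, `c • w ≠ w`): `T₀ ∈ M_n(F)` diagonal
non-degenerate (`0 < n`), `J = T₀ ⊗ 1`, `J^𝔻 = T^𝔻 ⊗ 1`, the split datum `D = localSplittingDatumSplit … χv` of the
doubled group `H(F_v) = U(J^𝔻)(F_v)` (`β = λ_Δ · χ_w(det ·_w)`, [Kudla1994, Thm 3.1]) and its UNDOUBLING
`s_v := undoubleLoc D.localSplitting : U(J)(F_v) →* S̃p_{ψ_v}(𝕎_v)` (`ω(s(g ⊕ 1))(f₁ ⊠ f₂) = ω(s_v g) f₁ ⊠ f₂`).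

MAIN RESULT (`exists_mixedModel_undoubleLoc_localSplittingDatumSplit`) — the hypotheses `(Γ, η, hΓi, hmodel, νK, hη)`
of the tree's `Liu2021.splitPlace_chiCoinv_iso_parabolicIndGL_explicit` for THIS splitting, with the character NAMED:
**there is an `L²`-isometric `Γ` with, for every `a ∈ GL_n(F_v)` and `Φ ∈ 𝒮(F_vⁿ)`,**

  `ω_{s_v}(κ_a) Φ = χ_w(det ι_w(a))⁻¹ • Γ⁻¹ (leviOpPi (x ↦ a⁻ᵀ x) (Γ Φ))`

(`κ_a ∈ U(J)(F_v)` of `w`-component `ι_w(a)`), i.e. `η = (χ_w ∘ det ∘ pr_w)⁻¹` and `νK = (χ_w ∘ ι_w)⁻¹` on `F_vˣ`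
(`inv_chi_det_symm_map`); with the CM normalisation `χv w := θ_w⁻¹` (`LocalDoubledUnitarySplittingDataCM`) it is `θ_w ∘ det`.

PROOF. §1 `J^𝔻_v γ^𝔻_w = (J_v γ_w) ⊕ (J⁻_v γ⁻_w)` along `e₂` (`symJ_mul_splitDarboux_gramD_eq`: `γ_w` is block-SCALAR,
`𝕋^𝔻_v = 𝕋_v ⊕ (−𝕋_v)`). §2 on products the doubled Levi operator of `a ⊕ 1` is `leviOpPi(a) ⊠ 1`. §3 `Γ ⊠ Γ₂` implements
`J^𝔻_v γ^𝔻_w` (`implements_of_boxSB`), so the doubled theorem `localOmega_localSplittingDatumSplit_symm_map` at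
`κ_{a ⊕ 1} = (κ_a) ⊕ 1` (`inlLoc_symm_map`) reads on `f₁ ⊠ f₂`; strip `f₂` (`toRep_undoubleLoc_boxSB`, `boxSB_left_cancel`).

Written for the d6 line of the cell `hodgecm-mathlib` (card S4b-3); nothing here is a claim of [Liu2021].

## References

* S. S. Kudla, Israel J. Math. 87 (1994) 361–401, §3, Thm 3.1 [Kudla1994].
* M. Harris, S. S. Kudla, W. J. Sweet, J. Amer. Math. Soc. 9 (1996), §1 (1.9), (1.15)–(1.16) [HarrisKudlaSweet1996].
* C. Mœglin, M.-F. Vignéras, J.-L. Waldspurger, LNM 1291 (1987), Chap. 2 II.1 Rem. (6), III.1; Chap. 3 III.1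
  [MoeglinVignerasWaldspurger1987].
* S. Gelbart, J. Rogawski, Invent. Math. 105 (1991), §3.1 Prop. 3.1.1, §3.2 p. 457 [GelbartRogawski1991].
-/

set_option autoImplicit false

noncomputable section

open NumberField IsDedekindDomain MeasureTheory Matrix
open Literature.RepresentationTheory.HeisenbergGroup Literature.RepresentationTheory.HeisenbergGroup.SymplecticMatrix
open Literature.NumberTheory.Automorphic Literature.NumberTheory.Automorphic.UnitaryGroup Literature.NumberTheory.Weil1964
open Literature.NumberTheory.GaloisRepresentations.IsNonarchimedeanLocalField
open Literature.GroupTheory Literature.LinearAlgebra.QuadraticForm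

namespace Literature.NumberTheory.GelbartRogawski1991.UnitaryDualPair.LocalSplitting

variable (F : Type) [Field F] [NumberField F] (E : Type) [Field E] [NumberField E] [Algebra F E]
  [Algebra.IsQuadraticExtension F E] (c : E ≃ₐ[F] E)
  {δ : E} (hcδ : c δ = -δ) (hδ : δ ≠ 0) {d : F} (hd : δ * δ = algebraMap F E d)
  (v : HeightOneSpectrum (𝓞 F))
  [MeasurableSpace (v.adicCompletion F)] [BorelSpace (v.adicCompletion F)]
  (μ : Measure (v.adicCompletion F)) [μ.IsAddHaarMeasure]
  (n : ℕ) {T₀ : Matrix (Fin n) (Fin n) F} (hT₀ : T₀.IsSymm) (hT₀d : IsUnit T₀.det)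
  {J : Matrix (Fin n) (Fin n) E} (hJ : J = T₀.map (algebraMap F E))
  {JD : Matrix (Fin (n + n)) (Fin (n + n)) E} (hJD : JD = (gramD F n T₀).map (algebraMap F E))


/-! ## §0 Block algebra along `e₂ : Fin n ⊕ Fin n ≃ Fin (n + n)` -/

section Blocks

variable {R : Type*} [CommRing R] {ι₁ ι₂ ι : Type*} [Fintype ι₁] [Fintype ι₂] [Fintype ι]
  [DecidableEq ι₁] [DecidableEq ι₂] [DecidableEq ι] (e : ι₁ ⊕ ι₂ ≃ ι)

omit [DecidableEq ι₁] [DecidableEq ι₂] [DecidableEq ι] in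
/-- `(A ⊕ B) z = A z|₁ ⊔ B z|₂` for a block-diagonal matrix re-enumerated along `e`. [cite: HarrisKudlaSweet1996, §1 (1.9)] -/
theorem reindex_fromBlocks_mulVec_eq_glue (A : Matrix ι₁ ι₁ R) (B : Matrix ι₂ ι₂ R) (z : ι → R) :
    Matrix.reindex e e (Matrix.fromBlocks A 0 0 B) *ᵥ z = glue e (A *ᵥ resL e z) (B *ᵥ resR e z) := by
  have hz : z ∘ e = Sum.elim (resL e z) (resR e z) := by
    funext s; rcases s with i | j <;> rfl
  rw [Matrix.reindex_apply, Matrix.submatrix_mulVec_equiv, Equiv.symm_symm, hz, Matrix.fromBlocks_mulVec,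
    Matrix.zero_mulVec, Matrix.zero_mulVec, add_zero, zero_add]
  rfl

omit [Fintype ι₁] [Fintype ι₂] [Fintype ι] [DecidableEq ι₁] [DecidableEq ι₂] [DecidableEq ι] in
/-- `(-a) ⊔ (-b) = -(a ⊔ b)`. [cite: HarrisKudlaSweet1996, §1 (1.9)] -/
theorem glue_neg (a : ι₁ → R) (b : ι₂ → R) : glue e (-a) (-b) = -glue e a b := by
  funext k
  obtain ⟨s, rfl⟩ := e.surjective k
  rcases s with i | j
  · simp
  · simp

end Blocks

/-! ## §1 The Darboux data of the doubled space are the sums of those of `𝕍` and `−𝕍` -/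

omit [NumberField F] in
include hT₀d in
/-- `det (−T₀)` is a unit. [cite: HarrisKudlaSweet1996, §1 (1.9)] -/
theorem isUnit_det_neg₀ : IsUnit (-T₀).det := by
  rw [Matrix.det_neg]
  exact ((isUnit_one.neg).pow _).mul hT₀d

omit [MeasurableSpace (v.adicCompletion F)] [BorelSpace (v.adicCompletion F)] in
include hT₀d in
/-- `det 𝕋_v` is a unit. [cite: HarrisKudlaSweet1996, §1 (1.9)] -/
theorem isUnit_det_localGram₀ : IsUnit (localGram F n T₀ v).det :=
  UnitaryGroup.isUnit_det_map (algebraMap F (v.adicCompletion F)) hT₀d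

omit [MeasurableSpace (v.adicCompletion F)] [BorelSpace (v.adicCompletion F)] in
include hT₀d in
/-- `det (−𝕋_v)` is a unit. [cite: HarrisKudlaSweet1996, §1 (1.9)] -/
theorem isUnit_det_localGram_neg' : IsUnit (localGram F n (-T₀) v).det :=
  UnitaryGroup.isUnit_det_map (algebraMap F (v.adicCompletion F)) (isUnit_det_neg₀ F n hT₀d)

omit [MeasurableSpace (v.adicCompletion F)] [BorelSpace (v.adicCompletion F)] in
/-- `𝕋^𝔻_v = 𝕋_v ⊕ 𝕋⁻_v` with `𝕋⁻_v` the local Gram matrix of `−T₀`. [cite: HarrisKudlaSweet1996, §1 (1.9)] -/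
theorem localGram_gramD_eq_fromBlocks :
    localGram F (n + n) (gramD F n T₀) v =
      Matrix.reindex (e₂ n) (e₂ n) (Matrix.fromBlocks (localGram F n T₀ v) 0 0 (localGram F n (-T₀) v)) := by
  have h : localGram F n (-T₀) v = -(localGram F n T₀ v) := Matrix.map_neg _ (map_neg (algebraMap F (v.adicCompletion F))) T₀
  rw [h]
  exact localGram_gramD F v n T₀

omit [MeasurableSpace (v.adicCompletion F)] [BorelSpace (v.adicCompletion F)] in
/-- **`J^𝔻_v γ^𝔻_w = (J_v γ_w) ⊕ (J⁻_v γ⁻_w)`**: the Darboux element `γ_w (x, y) = (x + δ_w y, −(2δ_w)⁻¹x + ½y)` of a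
split place is block-scalar (the SAME scalars in every rank and for every Gram matrix) and the Weyl element
`J (x, y) = (−𝕋 y, 𝕋⁻¹ x)` of `𝕋^𝔻 = 𝕋 ⊕ (−𝕋)` is block-diagonal, so the element `J_v γ_w` of the tree's
`SplitPlaceMixedModel.iota_symm_map_eq_conj` for the doubled space is the sum of those of the two summands along
`e₂`. [cite: MoeglinVignerasWaldspurger1987, Chap. 2 III.1; HarrisKudlaSweet1996, §1 (1.9)] -/
theorem symJ_mul_splitDarboux_gramD_eq (w : PlacesOver E v) (hw : c • w.1 ≠ w.1) :
    transportSp (localGram F (n + n) (gramD F n T₀) v) (isUnit_det_localGram_gramD F v n hT₀d)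
          (SymplecticGroup.symJ _ _) *
        splitDarboux F E c (n + n) hcδ hδ hd (gramD F n T₀) v (gramD_isSymm F n hT₀) w hw =
      spInl (e₂ n) (localGram F n T₀ v) (localGram F n (-T₀) v) (localGram_gramD_eq_fromBlocks F v n)
          (transportSp (localGram F n T₀ v) (isUnit_det_localGram₀ F v n hT₀d) (SymplecticGroup.symJ _ _) *
            splitDarboux F E c n hcδ hδ hd T₀ v hT₀ w hw) *
        spInr (e₂ n) (localGram F n T₀ v) (localGram F n (-T₀) v) (localGram_gramD_eq_fromBlocks F v n)
          (transportSp (localGram F n (-T₀) v) (isUnit_det_localGram_neg' F v n hT₀d) (SymplecticGroup.symJ _ _) *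
            splitDarboux F E c n hcδ hδ hd (-T₀) v hT₀.neg w hw) := by
  have h₁ := isUnit_det_localGram₀ F v n hT₀d
  have h₂ := isUnit_det_localGram_neg' F v n hT₀d
  -- `(𝕋^𝔻)⁻¹ = 𝕋⁻¹ ⊕ (𝕋⁻)⁻¹`
  have hinv : (localGram F (n + n) (gramD F n T₀) v)⁻¹ =
      Matrix.reindex (e₂ n) (e₂ n) (Matrix.fromBlocks (localGram F n T₀ v)⁻¹ 0 0 (localGram F n (-T₀) v)⁻¹) := by
    apply Matrix.inv_eq_right_inv
    rw [localGram_gramD_eq_fromBlocks, Matrix.reindex_apply, Matrix.reindex_apply, Matrix.submatrix_mul_equiv,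
      Matrix.fromBlocks_multiply]
    simp only [Matrix.mul_zero, Matrix.zero_mul, add_zero, zero_add, Matrix.mul_nonsing_inv _ h₁,
      Matrix.mul_nonsing_inv _ h₂, Matrix.fromBlocks_one, Matrix.submatrix_one_equiv]
  refine Subtype.ext (LinearEquiv.ext fun p => ?_)
  -- the Weyl elements `J (x, y) = (−𝕋 y, 𝕋⁻¹ x)` and the block-scalar `γ_w`, evaluated
  simp only [transportSp_J, Subgroup.coe_mul, LinearEquiv.mul_apply, coe_weylSp, weylσ_apply, weylGamma_apply,
    gramEquiv_symm_apply, coe_splitDarboux_apply, coe_spInl, coe_spInr, inrW_apply, inlW_apply, resL_glue, resR_glue]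
  refine Prod.ext ?_ ?_
  · -- first components: `−𝕋^𝔻(t x + u y) = (−𝕋(t x|₁ + u y|₁)) ⊔ (−𝕋⁻(t x|₂ + u y|₂))`
    rw [localGram_gramD_eq_fromBlocks, reindex_fromBlocks_mulVec_eq_glue, ← glue_neg]
    rfl
  · -- second components: `(𝕋^𝔻)⁻¹(x + s y) = 𝕋⁻¹(x|₁ + s y|₁) ⊔ (𝕋⁻)⁻¹(x|₂ + s y|₂)`
    rw [hinv, reindex_fromBlocks_mulVec_eq_glue]
    rfl

/-! ## §2 The doubled Levi operator of `a ⊕ 1` on products -/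

omit [MeasurableSpace (v.adicCompletion F)] [BorelSpace (v.adicCompletion F)] in
/-- `a ⊕ 1 ∈ GL_{n+n}(F_v)` along `e₂`. [cite: GelbartRogawski1991, §3.1 Prop. 3.1.1 p. 455] -/
theorem coe_reindexGL_blockDiagGL_one (a : GL (Fin n) (v.adicCompletion F)) :
    ((UnitaryGroup.reindexGL (e₂ n) (UnitaryGroup.blockDiagGL (a, (1 : GL (Fin n) (v.adicCompletion F)))) : GL (Fin (n + n)) (v.adicCompletion F)) :
        Matrix (Fin (n + n)) (Fin (n + n)) (v.adicCompletion F)) =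
      Matrix.reindex (e₂ n) (e₂ n) (Matrix.fromBlocks (a : Matrix (Fin n) (Fin n) (v.adicCompletion F)) 0 0 1) := by
  rw [UnitaryGroup.coe_reindexGL, UnitaryGroup.coe_blockDiagGL, Units.val_one]

omit [MeasurableSpace (v.adicCompletion F)] [BorelSpace (v.adicCompletion F)] in
/-- `det (a ⊕ 1) = det a`. [cite: GelbartRogawski1991, §3.1 Prop. 3.1.1 p. 455] -/
theorem det_reindexGL_blockDiagGL_one (a : GL (Fin n) (v.adicCompletion F)) :
    Matrix.GeneralLinearGroup.det (UnitaryGroup.reindexGL (e₂ n) (UnitaryGroup.blockDiagGL (a, (1 : GL (Fin n) (v.adicCompletion F))))) =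
      Matrix.GeneralLinearGroup.det a := by
  apply Units.ext
  rw [Matrix.GeneralLinearGroup.val_det_apply, Matrix.GeneralLinearGroup.val_det_apply,
    coe_reindexGL_blockDiagGL_one, Matrix.det_reindex_self, Matrix.det_fromBlocks_zero₂₁, Matrix.det_one, mul_one]

omit [MeasurableSpace (v.adicCompletion F)] [BorelSpace (v.adicCompletion F)] in
/-- `det (a ⊕ 1)⁻ᵀ = det a⁻ᵀ`. [cite: GelbartRogawski1991, §3.1 Prop. 3.1.1 p. 455] -/
theorem det_contragredient_reindexGL_blockDiagGL_one (a : GL (Fin n) (v.adicCompletion F)) :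
    ((GLn.contragredient (UnitaryGroup.reindexGL (e₂ n) (UnitaryGroup.blockDiagGL (a, (1 : GL (Fin n) (v.adicCompletion F))))) :
        GL (Fin (n + n)) (v.adicCompletion F)) : Matrix (Fin (n + n)) (Fin (n + n)) (v.adicCompletion F)).det =
      ((GLn.contragredient a : GL (Fin n) (v.adicCompletion F)) : Matrix (Fin n) (Fin n) (v.adicCompletion F)).det := by
  rw [GLn.coe_contragredient, GLn.coe_contragredient, Matrix.det_transpose, Matrix.det_transpose,
    ← Matrix.GeneralLinearGroup.val_det_apply, ← Matrix.GeneralLinearGroup.val_det_apply, map_inv, map_inv,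
    det_reindexGL_blockDiagGL_one]

omit [MeasurableSpace (v.adicCompletion F)] [BorelSpace (v.adicCompletion F)] in
/-- **the doubled Levi operator of `a ⊕ 1` acts on products through the first factor**:
`r(m((a ⊕ 1)⁻ᵀ)) (φ₁ ⊠ φ₂) = r(m(a⁻ᵀ)) φ₁ ⊠ φ₂` (`|det (a ⊕ 1)| = |det a|`, `(a ⊕ 1)ᵀ x = aᵀ x|₁ ⊔ x|₂`).
[cite: MoeglinVignerasWaldspurger1987, Chap. 2 II.1 Rem. (6), Chap. 3 III.1] -/
theorem leviOpPi_contragredient_inl_boxSB (a : GL (Fin n) (v.adicCompletion F)) (φ₁ φ₂ : (SchwartzBruhat (Fin n → v.adicCompletion F))) :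
    leviOpPi (glEquiv (GLn.contragredient (UnitaryGroup.reindexGL (e₂ n) (UnitaryGroup.blockDiagGL (a, (1 : GL (Fin n) (v.adicCompletion F)))))))
        (boxSB (v.adicCompletion F) (e₂ n) φ₁ φ₂) =
      boxSB (v.adicCompletion F) (e₂ n) (leviOpPi (glEquiv (GLn.contragredient a)) φ₁) φ₂ := by
  apply Subtype.ext
  funext x
  rw [Liu2021.SplitPlaceMixedModel.coe_leviOpPi_contragredient_apply, coe_boxSB, coe_boxSB]
  dsimp only
  rw [Liu2021.SplitPlaceMixedModel.coe_leviOpPi_contragredient_apply, modSqrt_glEquiv, modSqrt_glEquiv,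
    det_contragredient_reindexGL_blockDiagGL_one, coe_reindexGL_blockDiagGL_one,
    Matrix.transpose_reindex, Matrix.fromBlocks_transpose, Matrix.transpose_zero,
    Matrix.transpose_one, reindex_fromBlocks_mulVec_eq_glue, Matrix.one_mulVec, resL_glue, resR_glue, mul_assoc]

/-! ## §3 `κ_{a ⊕ 1} = κ_a ⊕ 1` and the undoubled mixed model -/

omit [Algebra.IsQuadraticExtension F E] [MeasurableSpace (v.adicCompletion F)] [BorelSpace (v.adicCompletion F)] in
/-- a scalar-extended block-diagonal matrix is block-diagonal: `ι_w(a ⊕ 1) = ι_w(a) ⊕ 1`.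
[cite: GelbartRogawski1991, §3.1 Prop. 3.1.1 p. 455] -/
theorem map_reindexGL_blockDiagGL_one (w : PlacesOver E v) (a : GL (Fin n) (v.adicCompletion F)) :
    Matrix.GeneralLinearGroup.map (toPlace v w : (v.adicCompletion F) →+* w.1.adicCompletion E)
        (UnitaryGroup.reindexGL (e₂ n) (UnitaryGroup.blockDiagGL (a, (1 : GL (Fin n) (v.adicCompletion F))))) =
      UnitaryGroup.reindexGL (e₂ n) (UnitaryGroup.blockDiagGL
        (Matrix.GeneralLinearGroup.map (toPlace v w : (v.adicCompletion F) →+* w.1.adicCompletion E) a,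
          (1 : GL (Fin n) (w.1.adicCompletion E)))) := by
  refine Units.ext ?_
  rw [UnitaryGroup.coe_reindexGL, UnitaryGroup.coe_blockDiagGL, Units.val_one]
  change ((UnitaryGroup.reindexGL (e₂ n) (UnitaryGroup.blockDiagGL (a, (1 : GL (Fin n) (v.adicCompletion F)))) : GL (Fin (n + n)) (v.adicCompletion
      F)) :
      Matrix (Fin (n + n)) (Fin (n + n)) (v.adicCompletion F)).map (toPlace v w : (v.adicCompletion F) →+* w.1.adicCompletion E) = _
  rw [coe_reindexGL_blockDiagGL_one, UnitaryGroup.reindex_map, Matrix.fromBlocks_map,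
    Matrix.map_zero _ (map_zero _), Matrix.map_one _ (map_zero _) (map_one _)]
  rfl

omit [MeasurableSpace (v.adicCompletion F)] [BorelSpace (v.adicCompletion F)] in
/-- **`κ_{a ⊕ 1} = κ_a ⊕ 1`**: the element of `H(F_v)` with `w`-component `ι_w(a ⊕ 1)` is `inlLoc` of the element of
`U(J)(F_v)` with `w`-component `ι_w(a)`. [cite: GelbartRogawski1991, §3.1 Prop. 3.1.1 p. 455] -/
theorem inlLoc_symm_map (hc : c ≠ 1) (hJc : (J.map c)ᵀ = J) (hJDc : (JD.map c)ᵀ = JD) (w : PlacesOver E v)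
    (hw : c • w.1 ≠ w.1) (hJw : IsUnit (placeForm J w.1)) (hJDw : IsUnit (placeForm JD w.1)) (a : GL (Fin n) (v.adicCompletion F)) :
    inlLoc F E c v n hJ hJD ((localPiSplitEquiv c J hc hJc w hw hJw).symm
        (Matrix.GeneralLinearGroup.map (toPlace v w) a)) =
      (localPiSplitEquiv c JD hc hJDc w hw hJDw).symm (Matrix.GeneralLinearGroup.map (toPlace v w)
        (UnitaryGroup.reindexGL (e₂ n) (UnitaryGroup.blockDiagGL (a, (1 : GL (Fin n) (v.adicCompletion F)))))) := by
  apply (localPiSplitEquiv c JD hc hJDc w hw hJDw).injective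
  rw [ContinuousMulEquiv.apply_symm_apply, localPiSplitEquiv_apply, inlLoc_apply, map_reindexGL_blockDiagGL_one]
  congr 3
  exact (localPiSplitEquiv c J hc hJc w hw hJw).apply_symm_apply _

/-- **THE UNDOUBLED SPLIT DATUM IS THE MIXED MODEL TWISTED BY `χ_w(det)⁻¹`.** Let `D = localSplittingDatumSplit … χv`
be the split datum of the doubled group at a place `v` split in `E` (`T₀` diagonal, `0 < n`, `χv` a split pair,
trivial near `1`) and `s_v = undoubleLoc D.localSplitting` its undoubling to `U(J)(F_v)`. Then for every Haar measure
`μ'` on `F_v` there is an `L²(μ'ⁿ)`-ISOMETRIC linear automorphism `Γ` of `𝒮(F_vⁿ)` (an implementer of `J_v γ_w`) with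

  `ω_{s_v}(κ_a) Φ = (χ_w (det ι_w(a)))⁻¹ • Γ⁻¹ (leviOpPi (x ↦ a⁻ᵀ x) (Γ Φ))`   for all `a ∈ GL_n(F_v)`, `Φ`

— the hypotheses `(Γ, η, hΓi, hmodel)` of the tree's `splitPlace_chiCoinv_iso_parabolicIndGL_explicit` with
`η = (χ_w ∘ det ∘ pr_w)⁻¹`. [cite: Kudla1994, Thm 3.1; HarrisKudlaSweet1996, §1 (1.15)–(1.16); MoeglinVignerasWaldspurger1987, Chap. 3 III.1] -/
theorem exists_mixedModel_undoubleLoc_localSplittingDatumSplit (w : PlacesOver E v) (hw : c • w.1 ≠ w.1)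
    (χv : ∀ w : PlacesOver E v, (w.1.adicCompletion E)ˣ →* ℂˣ) (hχ : IsSplitPair F E c v w χv)
    (hχ1 : IsTrivialNearOne F E v w (χv w))
    (hn : 0 < n) (t : Fin n → F) (hT₀t : T₀ = Matrix.diagonal t)
    (hc : c ≠ 1) (hJc : (J.map c)ᵀ = J) (hJDc : (JD.map c)ᵀ = JD) (hJw : IsUnit (placeForm J w.1))
    (hJDw : IsUnit (placeForm JD w.1))
    (μ' : Measure (v.adicCompletion F)) [μ'.IsAddHaarMeasure] :
    ∃ Γ : (SchwartzBruhat (Fin n → v.adicCompletion F)) ≃ₗ[ℂ] (SchwartzBruhat (Fin n → v.adicCompletion F)),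
      (∀ Φ : (SchwartzBruhat (Fin n → v.adicCompletion F)), SchwartzBruhat.l2NormSq (Measure.pi fun _ : Fin n => μ') (Γ Φ) =
          SchwartzBruhat.l2NormSq (Measure.pi fun _ : Fin n => μ') Φ) ∧
      ∀ (a : GL (Fin n) (v.adicCompletion F)) (Φ : (SchwartzBruhat (Fin n → v.adicCompletion F))),
        (MpPsi.toRep (localSchrodinger F n T₀ v)).comp
            (undoubleLoc F E c v n hJ hJD hcδ hδ hd hT₀ hT₀d
              (localSplittingDatumSplit F E c hcδ hδ hd v μ n hT₀ hT₀d hJD w hw χv hχ1).localSplitting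
              (localSplittingDatumSplit F E c hcδ hδ hd v μ n hT₀ hT₀d hJD w hw χv hχ1).proj_localSplitting)
            ((localPiSplitEquiv c J hc hJc w hw hJw).symm (Matrix.GeneralLinearGroup.map (toPlace v w) a)) Φ =
          (((χv w (Matrix.GeneralLinearGroup.det (Matrix.GeneralLinearGroup.map
              (toPlace v w : (v.adicCompletion F) →+* w.1.adicCompletion E) a)))⁻¹ : ℂˣ) : ℂ) •
            Γ.symm (leviOpPi (glEquiv (GLn.contragredient a)) (Γ Φ)) := by
  classical
  set D := localSplittingDatumSplit F E c hcδ hδ hd v μ n hT₀ hT₀d hJD w hw χv hχ1 with hD_def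
  -- implementers: `Γ` of `J_v γ_w` (isometric), `Γ₂` of `J⁻_v γ⁻_w`, and `Γ ⊠ Γ₂`
  obtain ⟨Γ, hΓ, hΓi⟩ := exists_isometric_implementer_localSchrodinger (hTd := hT₀d) μ'
    (transportSp (localGram F n T₀ v) (isUnit_det_localGram₀ F v n hT₀d) (SymplecticGroup.symJ _ _) *
      splitDarboux F E c n hcδ hδ hd T₀ v hT₀ w hw)
  obtain ⟨Γ₂, hΓ₂⟩ := existsImplementer_localSchrodinger F n (-T₀) (isUnit_det_neg₀ F n hT₀d) v
    (transportSp (localGram F n (-T₀) v) (isUnit_det_localGram_neg' F v n hT₀d) (SymplecticGroup.symJ _ _) *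
      splitDarboux F E c n hcδ hδ hd (-T₀) v hT₀.neg w hw)
  have hsum1 : sumEndSB (v.adicCompletion F) (e₂ n) (Γ : (SchwartzBruhat (Fin n → v.adicCompletion F)) →ₗ[ℂ] (SchwartzBruhat (Fin n →
      v.adicCompletion F))) (Γ₂ : (SchwartzBruhat (Fin n → v.adicCompletion F)) →ₗ[ℂ] (SchwartzBruhat (Fin n → v.adicCompletion F))) ∘ₗ
      sumEndSB (v.adicCompletion F) (e₂ n) (Γ.symm : (SchwartzBruhat (Fin n → v.adicCompletion F)) →ₗ[ℂ] (SchwartzBruhat (Fin n → v.adicCompletion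
          F))) (Γ₂.symm : (SchwartzBruhat (Fin n → v.adicCompletion F)) →ₗ[ℂ] (SchwartzBruhat (Fin n → v.adicCompletion F))) = LinearMap.id := by
    rw [← sumEndSB_comp, ← sumEndSB_id (v.adicCompletion F) (e₂ n)]
    congr 1 <;> exact LinearMap.ext fun x => by simp
  have hsum2 : sumEndSB (v.adicCompletion F) (e₂ n) (Γ.symm : (SchwartzBruhat (Fin n → v.adicCompletion F)) →ₗ[ℂ] (SchwartzBruhat (Fin n →
      v.adicCompletion F))) (Γ₂.symm : (SchwartzBruhat (Fin n → v.adicCompletion F)) →ₗ[ℂ] (SchwartzBruhat (Fin n → v.adicCompletion F))) ∘ₗ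
      sumEndSB (v.adicCompletion F) (e₂ n) (Γ : (SchwartzBruhat (Fin n → v.adicCompletion F)) →ₗ[ℂ] (SchwartzBruhat (Fin n → v.adicCompletion F)))
          (Γ₂ : (SchwartzBruhat (Fin n → v.adicCompletion F)) →ₗ[ℂ] (SchwartzBruhat (Fin n → v.adicCompletion F))) = LinearMap.id := by
    rw [← sumEndSB_comp, ← sumEndSB_id (v.adicCompletion F) (e₂ n)]
    congr 1 <;> exact LinearMap.ext fun x => by simp
  obtain ⟨ΓD, hΓD, hΓD'⟩ : ∃ ΓD : (SchwartzBruhat (Fin (n + n) → v.adicCompletion F)) ≃ₗ[ℂ] (SchwartzBruhat (Fin (n + n) → v.adicCompletion F)),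
      (∀ f₁ f₂ : (SchwartzBruhat (Fin n → v.adicCompletion F)), ΓD (boxSB (v.adicCompletion F) (e₂ n) f₁ f₂) = boxSB (v.adicCompletion F) (e₂ n) (Γ
          f₁) (Γ₂ f₂)) ∧
      (∀ f₁ f₂ : (SchwartzBruhat (Fin n → v.adicCompletion F)), ΓD.symm (boxSB (v.adicCompletion F) (e₂ n) f₁ f₂) = boxSB (v.adicCompletion F) (e₂ n)
          (Γ.symm f₁) (Γ₂.symm f₂)) :=
    ⟨LinearEquiv.ofLinear _ _ hsum1 hsum2, fun f₁ f₂ => sumEndSB_boxSB (v.adicCompletion F) (e₂ n) _ _ f₁ f₂,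
      fun f₁ f₂ => sumEndSB_boxSB (v.adicCompletion F) (e₂ n) _ _ f₁ f₂⟩
  have hΓDimp := implements_of_boxSB (e₂ n) (localGram F n T₀ v) (localGram F n (-T₀) v)
    (localGram_gramD_eq_fromBlocks F v n)
    (isLocallyConstant_of_isContinuousNontrivial (isContinuousNontrivial_adeleAddCharAt F v))
    (continuous_toLinearMap₂'_left (localGram F n T₀ v)) (continuous_toLinearMap₂'_left (localGram F n (-T₀) v))
    (continuous_toLinearMap₂'_left (localGram F (n + n) (gramD F n T₀) v)) _ _ hΓ hΓ₂ (M := ΓD) hΓD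
  -- the conjugation property of `J^𝔻_v γ^𝔻_w = (J_v γ_w) ⊕ (J⁻_v γ⁻_w)` (the tree's `iota_symm_map_eq_conj`)
  have hsum := symJ_mul_splitDarboux_gramD_eq F E c hcδ hδ hd v n hT₀ hT₀d w hw
  have hED' : ∀ A : GL (Fin (n + n)) (v.adicCompletion F), iotaD F E c hcδ hδ hd v n hT₀ hJD
      ((localPiSplitEquiv c JD hc hJDc w hw hJDw).symm (Matrix.GeneralLinearGroup.map (toPlace v w) A)) =
        (spInl (e₂ n) (localGram F n T₀ v) (localGram F n (-T₀) v) (localGram_gramD_eq_fromBlocks F v n)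
            (transportSp (localGram F n T₀ v) (isUnit_det_localGram₀ F v n hT₀d) (SymplecticGroup.symJ _ _) *
              splitDarboux F E c n hcδ hδ hd T₀ v hT₀ w hw) *
          spInr (e₂ n) (localGram F n T₀ v) (localGram F n (-T₀) v) (localGram_gramD_eq_fromBlocks F v n)
            (transportSp (localGram F n (-T₀) v) (isUnit_det_localGram_neg' F v n hT₀d) (SymplecticGroup.symJ _ _) *
              splitDarboux F E c n hcδ hδ hd (-T₀) v hT₀.neg w hw))⁻¹ *
        transportSp (localGram F (n + n) (gramD F n T₀) v) (isUnit_det_localGram_gramD F v n hT₀d)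
          (levi (GLn.contragredient A)) *
        (spInl (e₂ n) (localGram F n T₀ v) (localGram F n (-T₀) v) (localGram_gramD_eq_fromBlocks F v n)
            (transportSp (localGram F n T₀ v) (isUnit_det_localGram₀ F v n hT₀d) (SymplecticGroup.symJ _ _) *
              splitDarboux F E c n hcδ hδ hd T₀ v hT₀ w hw) *
          spInr (e₂ n) (localGram F n T₀ v) (localGram F n (-T₀) v) (localGram_gramD_eq_fromBlocks F v n)
            (transportSp (localGram F n (-T₀) v) (isUnit_det_localGram_neg' F v n hT₀d) (SymplecticGroup.symJ _ _) *
              splitDarboux F E c n hcδ hδ hd (-T₀) v hT₀.neg w hw)) := fun A => by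
    rw [← hsum]
    exact Liu2021.SplitPlaceMixedModel.iota_symm_map_eq_conj F E c (n + n) hcδ hδ hd (gramD F n T₀)
      (gramD_isSymm F n hT₀) (isUnit_det_gramD F n hT₀d) hJD v hc hJDc w hw hJDw A
  refine ⟨Γ, hΓi, fun a Φ => ?_⟩
  obtain ⟨f₂, hf₂⟩ := exists_schwartzBruhat_pi_ne_zero (v.adicCompletion F) (Fin n)
  -- the doubled theorem at `κ_{a ⊕ 1}`, read on `Φ ⊠ f₂`
  have key := localOmega_localSplittingDatumSplit_symm_map F E c hcδ hδ hd v μ n hT₀ hT₀d hJD w hw χv hχ hχ1 hn t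
    hT₀t hc hJDc hJDw _ hED' ΓD hΓDimp
    (UnitaryGroup.reindexGL (e₂ n) (UnitaryGroup.blockDiagGL (a, (1 : GL (Fin n) (v.adicCompletion F))))) (boxSB (v.adicCompletion F) (e₂ n) Φ f₂)
  rw [← inlLoc_symm_map F E c v n hJ hJD hc hJc hJDc w hw hJw hJDw a, hΓD, leviOpPi_contragredient_inl_boxSB, hΓD',
    LinearEquiv.symm_apply_apply, map_reindexGL_blockDiagGL_one, det_reindexGL_blockDiagGL_one, ← boxSB_smul_left]
    at key
  -- `ω_D(g ⊕ 1)(Φ ⊠ f₂) = ω_{s_v}(g) Φ ⊠ f₂`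
  have hund := toRep_undoubleLoc_boxSB F E c v n hJ hJD hcδ hδ hd hT₀ hT₀d D.localSplitting D.proj_localSplitting
    ((localPiSplitEquiv c J hc hJc w hw hJw).symm (Matrix.GeneralLinearGroup.map (toPlace v w) a)) Φ f₂
  refine boxSB_left_cancel (v.adicCompletion F) (e₂ n) hf₂ ?_
  rw [MonoidHom.comp_apply]
  exact hund.symm.trans key

omit [MeasurableSpace (v.adicCompletion F)] [BorelSpace (v.adicCompletion F)] in
/-- **the character of the mixed model, NAMED**: with `Γ` as above the pair `(Γ, η)`,
`η := (χ_w ∘ det ∘ pr_w)⁻¹ : U(J)(F_v) →* ℂˣ`, satisfies the input shape `hmodel`/`hη` of the tree's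
`splitPlace_chiCoinv_iso_parabolicIndGL_explicit` with `νK := (χ_w ∘ ι_w)⁻¹` on `F_vˣ`:
`η κ_a = νK (det a)` (`det ι_w(a) = ι_w(det a)`). [cite: HarrisKudlaSweet1996, §1 (1.16); Kudla1994, Thm 3.1] -/
theorem inv_chi_det_symm_map (hc : c ≠ 1) (hJc : (J.map c)ᵀ = J) (w : PlacesOver E v) (hw : c • w.1 ≠ w.1)
    (hJw : IsUnit (placeForm J w.1)) (χw : (w.1.adicCompletion E)ˣ →* ℂˣ) (a : GL (Fin n) (v.adicCompletion F)) :
    (χw.comp (Matrix.GeneralLinearGroup.det.comp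
        (localPiSplitEquiv c J hc hJc w hw hJw).toMulEquiv.toMonoidHom))⁻¹
        ((localPiSplitEquiv c J hc hJc w hw hJw).symm (Matrix.GeneralLinearGroup.map (toPlace v w) a)) =
      (χw.comp (Units.map (toPlace v w : (v.adicCompletion F) →+* w.1.adicCompletion E).toMonoidHom))⁻¹
        (Matrix.GeneralLinearGroup.det a) := by
  rw [MonoidHom.inv_apply, MonoidHom.inv_apply]
  refine congrArg (·⁻¹) ?_
  change χw (Matrix.GeneralLinearGroup.det (localPiSplitEquiv c J hc hJc w hw hJw
    ((localPiSplitEquiv c J hc hJc w hw hJw).symm (Matrix.GeneralLinearGroup.map (toPlace v w) a)))) =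
    χw (Units.map (toPlace v w : (v.adicCompletion F) →+* w.1.adicCompletion E).toMonoidHom (Matrix.GeneralLinearGroup.det a))
  rw [ContinuousMulEquiv.apply_symm_apply, Matrix.GeneralLinearGroup.map_det]
  rfl

/-- **the `(Γ, η, hmodel)` triple VERBATIM** for the tree's `splitPlace_chiCoinv_iso_parabolicIndGL_explicit`: with
`η := (χ_w ∘ det ∘ pr_w)⁻¹ : U(J)(F_v) →* ℂˣ` (`pr_w = localPiSplitEquiv`), there is an `L²(μ'ⁿ)`-isometric `Γ` with
`ω_{s_v}(κ_a) Φ = η(κ_a) • Γ⁻¹ (leviOpPi (x ↦ a⁻ᵀ x) (Γ Φ))` for all `a`, `Φ`; `hη` is `inv_chi_det_symm_map`.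
[cite: Kudla1994, Thm 3.1; HarrisKudlaSweet1996, §1 (1.15)–(1.16); MoeglinVignerasWaldspurger1987, Chap. 3 III.1] -/
theorem exists_mixedModel_undoubleLoc_localSplittingDatumSplit' (w : PlacesOver E v) (hw : c • w.1 ≠ w.1)
    (χv : ∀ w : PlacesOver E v, (w.1.adicCompletion E)ˣ →* ℂˣ) (hχ : IsSplitPair F E c v w χv)
    (hχ1 : IsTrivialNearOne F E v w (χv w))
    (hn : 0 < n) (t : Fin n → F) (hT₀t : T₀ = Matrix.diagonal t)
    (hc : c ≠ 1) (hJc : (J.map c)ᵀ = J) (hJDc : (JD.map c)ᵀ = JD) (hJw : IsUnit (placeForm J w.1))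
    (hJDw : IsUnit (placeForm JD w.1))
    (μ' : Measure (v.adicCompletion F)) [μ'.IsAddHaarMeasure] :
    ∃ Γ : (SchwartzBruhat (Fin n → v.adicCompletion F)) ≃ₗ[ℂ] (SchwartzBruhat (Fin n → v.adicCompletion F)),
      (∀ Φ : (SchwartzBruhat (Fin n → v.adicCompletion F)), SchwartzBruhat.l2NormSq (Measure.pi fun _ : Fin n => μ') (Γ Φ) =
          SchwartzBruhat.l2NormSq (Measure.pi fun _ : Fin n => μ') Φ) ∧
      ∀ (a : GL (Fin n) (v.adicCompletion F)) (Φ : (SchwartzBruhat (Fin n → v.adicCompletion F))),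
        (MpPsi.toRep (localSchrodinger F n T₀ v)).comp
            (undoubleLoc F E c v n hJ hJD hcδ hδ hd hT₀ hT₀d
              (localSplittingDatumSplit F E c hcδ hδ hd v μ n hT₀ hT₀d hJD w hw χv hχ1).localSplitting
              (localSplittingDatumSplit F E c hcδ hδ hd v μ n hT₀ hT₀d hJD w hw χv hχ1).proj_localSplitting)
            ((localPiSplitEquiv c J hc hJc w hw hJw).symm (Matrix.GeneralLinearGroup.map (toPlace v w) a)) Φ =
          ((((χv w).comp (Matrix.GeneralLinearGroup.det.comp
              (localPiSplitEquiv c J hc hJc w hw hJw).toMulEquiv.toMonoidHom))⁻¹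
              ((localPiSplitEquiv c J hc hJc w hw hJw).symm (Matrix.GeneralLinearGroup.map (toPlace v w) a)) : ℂˣ) :
              ℂ) • Γ.symm (leviOpPi (glEquiv (GLn.contragredient a)) (Γ Φ)) := by
  obtain ⟨Γ, hΓi, h⟩ := exists_mixedModel_undoubleLoc_localSplittingDatumSplit F E c hcδ hδ hd v μ n hT₀ hT₀d hJ
    hJD w hw χv hχ hχ1 hn t hT₀t hc hJc hJDc hJw hJDw μ'
  refine ⟨Γ, hΓi, fun a Φ => ?_⟩
  rw [h a Φ, inv_chi_det_symm_map, MonoidHom.inv_apply, MonoidHom.comp_apply, Matrix.GeneralLinearGroup.map_det]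
  rfl

end Literature.NumberTheory.GelbartRogawski1991.UnitaryDualPair.LocalSplitting

end
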